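import Literature.Analysis.UnboundedOperators.LinearMildFlow
import Summits.AnomalousDissipation.AnomalousDissipation.Theorems.BaireTransferDenseLoudDesignerForcesErgodicLine

/-!
# The linear mild flow: norm continuity in time, Lipschitz dependence on the coefficients
# (tools stub `stub_linearMildFlowTools`, block N-R, line `ergodic-budget-selection-closing`,
# crux `BaireTransfer.DenseLoudDesignerForces`, stmt-AnomalousDissipation-1143)

Summit-side copy of the Literature theorem `Literature.Analysis.UnboundedOperators.exists_linearMildFlow`
(`Literature/Analysis/UnboundedOperators/LinearMildFlow.lean`, any real Banach space `E`): for strongly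
continuous contractions `T(t)`, norm continuous on `(0, ∞)`, a weakly singular family `K(t)`
(`‖K t‖ ≤ C t^{-α}`, `0 ≤ α < 1`), strongly and norm continuous on `(0, ∞)`, a horizon `τ > 0` and a
coefficient bound `β ≥ 0`, there are constants `C_W`, `L` such that every norm-continuous coefficient
family `B : [0, τ] → L(E)` with `‖B s‖ ≤ β` has solution operators `W(t) ∈ L(E)` of the LINEAR mild
(Volterra) equation

  `W(t) h = T(t) h − ∫₀ᵗ K(t − s) B(s) W(s) h ds`     (`0 ≤ t ≤ τ`),

with `t ↦ W(t) h` continuous, uniqueness among continuous solutions, `‖W(t)‖ ≤ C_W`, **`t ↦ W(t)`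
continuous in OPERATOR norm on `(0, τ]`**, and **`‖W_B(t) − W_{B'}(t)‖ ≤ L sup ‖B − B'‖`** for a second
family `B'` and any continuous family `W'` of its solution operators.

In block N-R this is applied with `E = Hsp`, `T = e^{-νtA}`, `K = A^{3/4} e^{-νtA}` and
`B_y(s) = Nb(y(s), ·) + Nb(·, y(s))` along a mild solution `y = Ψ y₀` of the smooth model: the derivative
field `∂_{y₀} Ψ(t, y₀) = W_{B_y}(t)` is then jointly continuous in operator norm on `(0, τ] × ball`
(norm continuity in `t` from this stub, Lipschitz dependence on `B` from this stub, continuity of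
`y₀ ↦ B_y` from S4c), which is what `contDiffOn_succ_of_partial` consumes.

Architecture of the proof (all in `Literature/Analysis/UnboundedOperators/`): the uniform-in-`g` time
modulus of the weakly singular Duhamel integral for a norm-continuous kernel
(`LinearMildFlowKernelContinuity.lean`, dominated convergence), the short-interval / small-coefficient
case by a Neumann series for `1 + Φ ∘ M_B` on `C([0, τ]; E)` with the resolvent identity for the
Lipschitz dependence (`LinearMildFlowSmall.lean`, on S2's Duhamel operator `exists_duhamelCLM`), and the
reduction of the general case by the exponential weight `e^{-γt}` (`LinearMildFlow.lean`; the
equivalent-norm form of Henry's singular Grönwall Lemma 7.1.1).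

References: D. Henry, *Geometric Theory of Semilinear Parabolic Equations*, LNM 840 (1981), Thm 1.4.3,
Thm 3.3.3, Thm 3.4.1, Cor. 3.4.6, §7.1, Lemma 7.1.1; A. Pazy, *Semigroups of Linear Operators and
Applications to PDE* (1983), §5.6, Thm 6.3.1.  Nothing is asserted; no definition is added.
-/

-- `Summit.<Summit>.<Problem>` is the tree's mandated summit-side namespace (CONVENTIONS §2); for this
-- single-conjunct summit the two coincide, so the duplicate is deliberate.
set_option linter.dupNamespace false

noncomputable section

open scoped BigOperators Topology ENNReal InnerProductSpace
open Filter Set Function MeasureTheory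

namespace Summit.AnomalousDissipation.AnomalousDissipation.Theorems.DenseLoudDesignerForces.Ergodic

open Literature.Analysis.FunctionSpaces Literature.Analysis.FunctionSpaces.Torus
open Literature.Analysis.FluidPDE Literature.Analysis.FluidPDE.Torus

/-- **Tools stub T5 of block N-R (`stub_linearMildFlowTools`) — the linear mild flow
`w(t) = T t h − ∫₀ᵗ K(t − s) B(s) w(s) ds`: existence, uniqueness, bounds, OPERATOR-norm continuity in
`t` on `(0, τ]` and Lipschitz dependence on the coefficient family `B`.**  For strongly continuous
contractions `T`, norm continuous on `(0, ∞)`, a weakly singular `K` (`‖K t‖ ≤ C t^{-α}`, `0 ≤ α < 1`),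
strongly and norm continuous on `(0, ∞)`, `τ > 0` and `β ≥ 0` there are `C_W`, `L` such that every
coefficient family `B`, norm continuous on `[0, τ]` with `‖B s‖ ≤ β`, has solution operators `W t` with:
the mild equation; `t ↦ W t h` continuous on `[0, τ]`; uniqueness among continuous solutions;
`‖W t‖ ≤ C_W`; `W` continuous on `(0, τ]` in operator norm; and `‖W t − W' t‖ ≤ L η` for the solution
operators `W'` of any second family `B'` with `‖B'‖ ≤ β`, `‖B − B'‖ ≤ η` —
`Literature.Analysis.UnboundedOperators.exists_linearMildFlow` (Henry 1981, §7.1, Lemma 7.1.1,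
Thm 3.4.1; proved there by an exponential weight and a Neumann series instead of the Grönwall lemma).
[cite: Henry1981, Lemma 7.1.1 and Thm 3.4.1] -/
theorem stub_linearMildFlowTools {E : Type*} [NormedAddCommGroup E] [NormedSpace ℝ E] [CompleteSpace E]
    (T K : ℝ → E →L[ℝ] E) (hTnorm : ∀ t, 0 ≤ t → ‖T t‖ ≤ 1) (hTc : ∀ y : E, Continuous fun t : ℝ => T t y) (hTn : ContinuousOn T (Ioi 0))
    {α C : ℝ} (hα₀ : 0 ≤ α) (hα : α < 1) (hC : 0 ≤ C) (hK : ∀ t, 0 < t → ‖K t‖ ≤ C * t ^ (-α))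
    (hKc : ∀ y : E, ContinuousOn (fun t : ℝ => K t y) (Ioi 0)) (hKn : ContinuousOn K (Ioi 0))
    {τ β : ℝ} (hτ : 0 < τ) (hβ : 0 ≤ β) :
    ∃ C_W L : ℝ, ∀ (B : ℝ → E →L[ℝ] E), ContinuousOn B (Icc 0 τ) → (∀ s ∈ Icc 0 τ, ‖B s‖ ≤ β) →
      ∃ W : ℝ → E →L[ℝ] E,
        (∀ (h : E) (t : Icc (0 : ℝ) τ), W t h = T t h - ∫ s in (0 : ℝ)..(t : ℝ), K ((t : ℝ) - s) (B s (W s h))) ∧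
        (∀ h : E, ContinuousOn (fun t : ℝ => W t h) (Icc 0 τ)) ∧
        (∀ (h : E) (z : C(Icc (0 : ℝ) τ, E)), (∀ t : Icc (0 : ℝ) τ, z t = T t h - ∫ s in (0 : ℝ)..(t : ℝ),
          K ((t : ℝ) - s) (B s (z (Set.projIcc 0 τ hτ.le s)))) → ∀ t : Icc (0 : ℝ) τ, z t = W t h) ∧
        (∀ t ∈ Icc 0 τ, ‖W t‖ ≤ C_W) ∧ ContinuousOn W (Ioc 0 τ) ∧
        ∀ (B' : ℝ → E →L[ℝ] E) (W' : ℝ → E →L[ℝ] E) (η : ℝ), ContinuousOn B' (Icc 0 τ) → (∀ s ∈ Icc 0 τ, ‖B' s‖ ≤ β) →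
          (∀ s ∈ Icc 0 τ, ‖B s - B' s‖ ≤ η) →
          (∀ (h : E) (t : Icc (0 : ℝ) τ), W' t h = T t h - ∫ s in (0 : ℝ)..(t : ℝ), K ((t : ℝ) - s) (B' s (W' s h))) →
          (∀ h : E, ContinuousOn (fun t : ℝ => W' t h) (Icc 0 τ)) →
          ∀ t ∈ Icc 0 τ, ‖W t - W' t‖ ≤ L * η :=
  Literature.Analysis.UnboundedOperators.exists_linearMildFlow T K hTnorm hTc hTn hα₀ hα hC hK hKc hKn
    hτ hβ

end Summit.AnomalousDissipation.AnomalousDissipation.Theorems.DenseLoudDesignerForces.Ergodic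

end
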